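import Summits.QuantumFields.GaugeBoot.Rows.GLYZc2D4HTab
import HarnessLib

/-!
# Gauge-boot: kernel check of the raw `H` class table of the glyz-c2-4D problems, rows 201–222 (part 13/20)

Cell `pub-gaugeboot` (HOME `run/shared/lean/pub/pub-gaugeboot/`), seat lean1 (torus layer for rows C76–C87 = the certified
glyz-c2-4D windows: label set, raw blocks, class/witness tables, the reduction identity, per-β bindings).

HONEST FRAMING (page 1 of every file of this cell): certified bounds on lattice expectations at STATED coupling,
gauge group, dimension and torus size; NOT a mass gap, NOT a continuum limit, NOT a string tension, NOT large `N`.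
The venture is explicitly NOT Yang–Mills-summit-bearing (barriers `FixedCouplingUltralocality`,
`PerturbativeInvisibility`).

`hcanon_rows_<lo>_<hi> : ∀ i, lo ≤ i < hi → ∀ j ≥ i, GLYZc2D4.HCanonOK i j`, each range one closed computation (`decide +kernel`);
assembled in `GLYZc2D4Canon`.
-/

noncomputable section

open Literature.MathematicalPhysics.QuantumFieldTheory

namespace Summit.QuantumFields.GaugeBoot

namespace GLYZc2D4

set_option maxHeartbeats 0 in
/-- Rows `201 ≤ i < 205` of the `H` class table of the glyz-c2-4D problems canonicalise (1186 entries; kernel). -/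
theorem hcanon_rows_201_205 : ∀ i : Fin 499, 201 ≤ i.val → i.val < 205 → ∀ j : Fin 499, i.val ≤ j.val → GLYZc2D4.HCanonOK i j := by
  decide +kernel

set_option maxHeartbeats 0 in
/-- Rows `205 ≤ i < 209` of the `H` class table of the glyz-c2-4D problems canonicalise (1170 entries; kernel). -/
theorem hcanon_rows_205_209 : ∀ i : Fin 499, 205 ≤ i.val → i.val < 209 → ∀ j : Fin 499, i.val ≤ j.val → GLYZc2D4.HCanonOK i j := by
  decide +kernel

set_option maxHeartbeats 0 in
/-- Rows `209 ≤ i < 213` of the `H` class table of the glyz-c2-4D problems canonicalise (1154 entries; kernel). -/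
theorem hcanon_rows_209_213 : ∀ i : Fin 499, 209 ≤ i.val → i.val < 213 → ∀ j : Fin 499, i.val ≤ j.val → GLYZc2D4.HCanonOK i j := by
  decide +kernel

set_option maxHeartbeats 0 in
/-- Rows `213 ≤ i < 218` of the `H` class table of the glyz-c2-4D problems canonicalise (1420 entries; kernel). -/
theorem hcanon_rows_213_218 : ∀ i : Fin 499, 213 ≤ i.val → i.val < 218 → ∀ j : Fin 499, i.val ≤ j.val → GLYZc2D4.HCanonOK i j := by
  decide +kernel

set_option maxHeartbeats 0 in
/-- Rows `218 ≤ i < 223` of the `H` class table of the glyz-c2-4D problems canonicalise (1395 entries; kernel). -/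
theorem hcanon_rows_218_223 : ∀ i : Fin 499, 218 ≤ i.val → i.val < 223 → ∀ j : Fin 499, i.val ≤ j.val → GLYZc2D4.HCanonOK i j := by
  decide +kernel

end GLYZc2D4

end Summit.QuantumFields.GaugeBoot

end
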